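import Literature.AlgebraicGeometry.AbelianVarieties.MarkmanShearFourierFunctor
import Literature.AlgebraicGeometry.Modules.DerivedPushforwardIsoBaseChange
import Literature.AlgebraicGeometry.Modules.PullbackTensorOfLocallyFree
import HarnessLib

/-!
# Markman's `Φ = (id × Ψ_{𝒫^∨}) ∘ μ^*` AS ONE SPAN TRANSFORM: the kernel shear `Ξ` of `(A × A) × Â`,
# `μ ∘ pr₁₂ ∘ Ξ = pr₁₂`, and `Φ ≅ Φ^{pr₁₂, g′}_{𝒩₁}` with `g′ = pr₁₃ ∘ Ξ`, `𝒩₁ = Ξ^* pr₂₃^* 𝒫^∨` (Markman 2025 §6, §9.3)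

Layer `Literature/AlgebraicGeometry/AbelianVarieties`; sequel to `MarkmanShearFourierFunctor`
(`markmanPhiPlus A hΘ hK = D⁺(μ^*) ⋙ relativeIntegralTransformPlus A A Â 𝒫^∨`, the relative transform being
`integralTransformPlus pr₁₂ pr₁₃ (pr₂₃^*𝒫^∨)` along the span `A×A ⟵ (A×A)×Â ⟶ A×Â`). Unfolding, for `M` on `A × A`,
`Φ(M) = R pr₁₃_*(pr₂₃^*𝒫^∨ ⊗ pr₁₂^* μ^* M)`. This file re-parametrises the middle object `Z = (A×A)×Â` by the
automorphism (the **kernel shear**)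

  `Ξ : Z ⥲ Z`, `(a, b, β) ↦ (a b⁻¹, b, β · φ_Θ(a b))`

(`kernelShearIso`; an automorphism of `ℂ`-schemes, inverse `(x₁, x₂, x₃) ↦ (x₁x₂, x₂, x₃ · φ_Θ(x₁x₂²)⁻¹)`), whose point
is **`Ξ ≫ pr₁₂ ≫ μ = pr₁₂`** (`kernelShearIso_hom_comp_pr₁₂_comp_shear`): after `Ξ` the source leg of Markman's
transform is the plain PROJECTION. Writing `g′ := Ξ ≫ pr₁₃ = (a b⁻¹, β · φ_Θ(ab))` (`kernelSpanMap`) and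
`𝒩₁ := Ξ^*(pr₂₃^*𝒫^∨)` (`markmanSpanKernel`, a line bundle on `Z`), base change of `R pr₁₃_*` along the
automorphism `Ξ` (`Modules/DerivedPushforwardIsoBaseChange`, the flat-base-change theorem in the trivial case) and the
pull-back of a one-sided-locally-free tensor product (`Modules/PullbackTensorOfLocallyFree`) give the FUNCTOR isomorphism

  **`markmanPhiPlus A hΘ hK ≅ integralTransformPlus pr₁₂ g′ 𝒩₁`**        (`markmanPhiPlusSpanIso`)

on `D⁺(Mod 𝒪_{A×A})`: Markman's `Φ` IS the integral transform with kernel the LINE BUNDLE `𝒩₁` along the span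
`A×A ⟵pr₁₂— (A×A)×Â —g′⟶ A×Â`. Consequence used downstream (not in this file): for `F = π^*F₀` pulled back from a
quotient of `A × A`, `Φ(F) = Rg′_*(𝒩₁ ⊗ pr₁₂^*π^*F₀)` — the group acts on the FIRST factor of `Z` only, and every
equivariance question about `Φ(F)` is a question about the line bundle `𝒩₁`.

* §0 `Modules.derivedPushforwardPlusPullbackIsoCompIso : D⁺(ε^*) ⋙ R(ε ≫ q)_* ≅ Rq_*` for an isomorphism of schemes `ε`
  (the degenerate flat base change, assembled from `Modules/DerivedPushforwardIsoBaseChange` §1–§2).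
* §1 `graphShearIso` (`(w, c) ↦ (w, c·ψ(w))`), `kernelShearIso A hΘ` (`Ξ := (μ⁻¹ × 1) ≫ graph shear of φ_Θ(x₁x₂²)`),
  `kernelShearSchemeIso`, the identity `kernelShearIso_hom_comp_pr₁₂_comp_shear` (`Ξ ≫ pr₁₂ ≫ μ = pr₁₂`),
  `kernelSpanMap` (`g′ := Ξ ≫ pr₁₃`), `kernelSliceMap` (`Ξ ≫ pr₂₃`), exactness of `Ξ^*`.
* §2 `markmanSpanKernel A hΘ hK := Ξ^*(pr₂₃^*𝒫^∨)` (finite locally free of rank one) and the module-level natural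
  isomorphism `markmanSpanKernelNatIso : μ^* ⋙ (pr₂₃^*𝒫^∨ ⊗ pr₁₂^*(–)) ⋙ Ξ^* ≅ (𝒩₁ ⊗ pr₁₂^*(–))`.
* §3 **`markmanPhiPlusSpanIso`** and its objectwise reading `nonempty_markmanPhiPlus_obj_iso`.

Print: `μ(x₁, x₂) = (x₁ + x₂, x₂)`, `Φ := (id × Ψ_{𝒫⁻¹[n]}) ∘ μ^*` [Markman §6 p. 26 L34, L51]; the shift `[n]` and the §9.2
source twist `[Θ ⊠ Θ] ⊗` are omitted exactly as in `MarkmanShearFourierFunctor` (the twist is absorbed into the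
kernel by the consumer: `𝒩₁ ⊗ pr₁₂^*(Θ ⊠ Θ)`). Everything PROVED; 0 named facts; no instances (exactness hypotheses are
instance BINDERS with discharging theorems, as in `MarkmanPhiExchange`). Typed for the cell `pub-hodge-ring2` (plate F17
of crux 26512's architecture (K): "descend the kernel, not the image"); a research route conditional on HC_CM, not a
corollary — nothing in this file refers to it.

## References

* E. Markman, *Cycles on abelian 2n-folds of Weil type…*, arXiv:2502.03415 (2025), §6 p. 26 L34–51, §9.3 p. 71 L44–70. [Markman2025SecantWeil]
* S. Mukai, *Duality between `D(X)` and `D(X̂)`…*, Nagoya Math. J. 81 (1981), §1 (1.1), (1.4). [Mukai1981]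
* R. Hartshorne, *Algebraic Geometry* (1977), II §5 p. 110, III Prop. 8.1, III Prop. 9.3. [Hartshorne1977]
* The Stacks Project, Tag 01CA (pull-back of tensor products). [StacksProject]
-/

noncomputable section

-- `TopCat.Presheaf`/`Scheme.Modules` are not reducible (as in Mathlib's `AlgebraicGeometry/Modules/Sheaf.lean`).
set_option backward.isDefEq.respectTransparency false

open CategoryTheory CategoryTheory.Limits AlgebraicGeometry MonoidalCategory CartesianMonoidalCategory
open AlgebraicGeometry.Scheme.Modules

universe w₁ w₂ w₃ u

/-! ### §0 `D⁺(ε^*) ⋙ R(ε ≫ q)_* ≅ Rq_*` for an isomorphism `ε` -/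

namespace Literature.AlgebraicGeometry.Modules

variable {P' P Y : Scheme.{u}} [HasDerivedCategory.{w₁} P'.Modules] [HasDerivedCategory.{w₂} P.Modules]
  [HasDerivedCategory.{w₃} Y.Modules]

/-- **`D⁺(ε^*) ⋙ R(ε ≫ q)_* ≅ Rq_*` for an isomorphism of schemes `ε : P' ≅ P`** (`ε^* = (ε⁻¹)_*` is exact and
preserves injectives, and `ε⁻¹ ≫ ε ≫ q = q`): computing `Rq_*` after re-parametrising the source by an automorphism.
The exactness instance of `ε^*` is a binder (`preservesFiniteLimits_pullback_of_iso`). [cite: Hartshorne1977, II §5 p. 110 and III Prop. 8.1] -/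
def derivedPushforwardPlusPullbackIsoCompIso (ε : P' ≅ P) (q : P ⟶ Y) [PreservesFiniteLimits (Scheme.Modules.pullback ε.hom)] :
    (Scheme.Modules.pullback ε.hom).mapDerivedCategoryPlus ⋙ derivedPushforwardPlus (ε.hom ≫ q) ≅ derivedPushforwardPlus q :=
  haveI := preservesFiniteLimits_pushforward_inv_of_iso ε
  haveI := preservesFiniteColimits_pushforward_inv_of_iso ε
  Functor.isoWhiskerRight (Functor.mapDerivedCategoryPlusIsoOfIso _ _ (pullbackIsoPushforwardInv ε)) _ ≪≫
    derivedPushforwardPlusExactCompIso ε.inv (ε.hom ≫ q) (injective_pushforward_obj_of_iso ε.symm) ≪≫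
    Functor.rightDerivedFunctorPlusIsoOfIso _ _ (pushforwardCongr (ε.inv_hom_id_assoc q))

end Literature.AlgebraicGeometry.Modules

namespace Literature.AlgebraicGeometry.AbelianVarieties

open Literature.AlgebraicGeometry.Motives Literature.AlgebraicGeometry.Modules
open scoped MonObj

variable (A : AbelianVariety ℂ) {Θ : CartierDivisor A.X.left} (hΘ : Θ.IsAmple)

/-! ### §1 The kernel shear `Ξ : (a, b, β) ↦ (a b⁻¹, b, β · φ_Θ(ab))` of `(A × A) × Â` -/

section Shear

/-- The polarisation isogeny `φ_Θ : A → Â` as a morphism of `ℂ`-schemes. [cite: Markman2025SecantWeil, §9.3 p. 71 L44–70] -/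
abbrev phiThetaOver : A.X ⟶ (A.dualOf Θ hΘ).X := (A.phiTheta Θ hΘ).hom.hom.hom

/-- **A graph shear `(w, c) ↦ (w, c · ψ(w))` of `W × C`** for a morphism `ψ : W → C` into a group object `C` (an
automorphism of `W × C` over `W`, inverse `(w, c) ↦ (w, c · ψ(w)⁻¹)`). Plumbing with body.
[cite: GortzWedhorn2023, Def./Rem. 27.1 (p. 799)] -/
def graphShearIso {W : SchemeOver ℂ} (C : AbelianVariety ℂ) (ψ : W ⟶ C.X) : W ⊗ C.X ≅ W ⊗ C.X where
  hom := lift (fst W C.X) (snd W C.X * (fst W C.X ≫ ψ))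
  inv := lift (fst W C.X) (snd W C.X * (fst W C.X ≫ ψ)⁻¹)
  hom_inv_id := by
    ext
    · rw [Category.assoc, lift_fst, lift_fst, Category.id_comp]
    · rw [Category.assoc, lift_snd, MonObj.comp_mul, lift_snd, GrpObj.comp_inv, lift_fst_assoc, mul_inv_cancel_right,
        Category.id_comp]
  inv_hom_id := by
    ext
    · rw [Category.assoc, lift_fst, lift_fst, Category.id_comp]
    · rw [Category.assoc, lift_snd, MonObj.comp_mul, lift_snd, lift_fst_assoc, inv_mul_cancel_right, Category.id_comp]

/-- `graphShear ≫ pr₁ = pr₁`. [cite: GortzWedhorn2023, Def./Rem. 27.1 (p. 799)] -/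
@[simp]
theorem graphShearIso_hom_comp_fst {W : SchemeOver ℂ} (C : AbelianVariety ℂ) (ψ : W ⟶ C.X) :
    (graphShearIso C ψ).hom ≫ fst W C.X = fst W C.X := lift_fst _ _

/-- `graphShear ≫ pr₂ = pr₂ · ψ(pr₁)`. [cite: GortzWedhorn2023, Def./Rem. 27.1 (p. 799)] -/
@[simp]
theorem graphShearIso_hom_comp_snd {W : SchemeOver ℂ} (C : AbelianVariety ℂ) (ψ : W ⟶ C.X) :
    (graphShearIso C ψ).hom ≫ snd W C.X = snd W C.X * (fst W C.X ≫ ψ) := lift_snd _ _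

/-- **The kernel shear `Ξ : (A × A) × Â ⥲ (A × A) × Â`, `(a, b, β) ↦ (a b⁻¹, b, β · φ_Θ(a b))`** — the composite of
`μ⁻¹ × 1_Â` (`μ` the shear of `MarkmanShearFourierFunctor`, `μ⁻¹(a, b) = (a b⁻¹, b)`) with the graph shear of
`ψ = φ_Θ ∘ (x₁ x₂ · x₂)` (so that `ψ(a b⁻¹, b) = φ_Θ(ab)`); an automorphism of `ℂ`-schemes. It conjugates the translation
`t_{(u₁, u₂)} × 1` to print's `(τ_{x₁ − x₂}, τ_{x₂}) × τ_{φ_Θ(x₁ + x₂)}` [Markman §9.3 p. 71 L54–56].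
[cite: Markman2025SecantWeil, §9.3 p. 71 L44–70] -/
def kernelShearIso : (A.X ⊗ A.X) ⊗ (A.dualOf Θ hΘ).X ≅ (A.X ⊗ A.X) ⊗ (A.dualOf Θ hΘ).X :=
  whiskerRightIso (shearIso A).symm (A.dualOf Θ hΘ).X ≪≫
    graphShearIso (A.dualOf Θ hΘ) ((fst A.X A.X * snd A.X A.X * snd A.X A.X) ≫ phiThetaOver A hΘ)

/-- `Ξ ≫ pr₁₂ = pr₁₂ ≫ μ⁻¹`. [cite: Markman2025SecantWeil, §6 p. 26 L34 and §9.3 p. 71 L54–56] -/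
theorem kernelShearIso_hom_comp_pr₁₂ :
    (kernelShearIso A hΘ).hom ≫ pr₁₂ A A (A.dualOf Θ hΘ) = pr₁₂ A A (A.dualOf Θ hΘ) ≫ (shearIso A).inv := by
  rw [kernelShearIso, Iso.trans_hom, Category.assoc, graphShearIso_hom_comp_fst, whiskerRightIso_hom, Iso.symm_hom,
    whiskerRight_fst]

/-- **`Ξ ≫ pr₁₂ ≫ μ = pr₁₂`**: after the kernel shear, Markman's source leg `μ ∘ pr₁₂` is the plain projection.
[cite: Markman2025SecantWeil, §6 p. 26 L34 and §9.3 p. 71 L54–56] -/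
theorem kernelShearIso_hom_comp_pr₁₂_comp_shear :
    (kernelShearIso A hΘ).hom ≫ pr₁₂ A A (A.dualOf Θ hΘ) ≫ (shearIso A).hom = pr₁₂ A A (A.dualOf Θ hΘ) := by
  rw [← Category.assoc, kernelShearIso_hom_comp_pr₁₂, Category.assoc, Iso.inv_hom_id, Category.comp_id]

/-- The kernel shear on underlying schemes. [cite: Markman2025SecantWeil, §9.3 p. 71 L44–70] -/
def kernelShearSchemeIso : ((A.X ⊗ A.X) ⊗ (A.dualOf Θ hΘ).X).left ≅ ((A.X ⊗ A.X) ⊗ (A.dualOf Θ hΘ).X).left :=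
  (Over.forget _).mapIso (kernelShearIso A hΘ)

/-- `Ξ^*` is exact (pull-back along an isomorphism). [cite: Hartshorne1977, II §5 p. 110] -/
theorem preservesFiniteLimits_pullback_kernelShear :
    PreservesFiniteLimits (Scheme.Modules.pullback (kernelShearSchemeIso A hΘ).hom) :=
  preservesFiniteLimits_pullback_of_iso _

/-- On schemes: `Ξ ≫ pr₁₂ ≫ μ = pr₁₂`. [cite: Markman2025SecantWeil, §6 p. 26 L34 and §9.3 p. 71 L54–56] -/
theorem kernelShearSchemeIso_hom_comp :
    (kernelShearSchemeIso A hΘ).hom ≫ (pr₁₂ A A (A.dualOf Θ hΘ)).left ≫ (shearSchemeIso A).hom =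
      (pr₁₂ A A (A.dualOf Θ hΘ)).left := by
  change (kernelShearIso A hΘ).hom.left ≫ (pr₁₂ A A (A.dualOf Θ hΘ)).left ≫ (shearIso A).hom.left = _
  rw [← Over.comp_left, ← Over.comp_left, kernelShearIso_hom_comp_pr₁₂_comp_shear]

/-- **The second leg `g′ := Ξ ≫ pr₁₃ : (A × A) × Â → A × Â` of the span** (on `ℂ`-points: `(a, b, β) ↦ (a b⁻¹, β · φ_Θ(ab))`,
print's `(x₁ − x₂, L_{x₁ + x₂})`). [cite: Markman2025SecantWeil, §9.3 p. 71 L54–70] -/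
def kernelSpanMap : (A.X ⊗ A.X) ⊗ (A.dualOf Θ hΘ).X ⟶ A.X ⊗ (A.dualOf Θ hΘ).X :=
  (kernelShearIso A hΘ).hom ≫ pr₁₃ A A (A.dualOf Θ hΘ)

/-- On schemes: `Ξ ≫ pr₁₃ = g′` (definitional). [cite: Markman2025SecantWeil, §9.3 p. 71 L54–70] -/
theorem kernelShearSchemeIso_hom_comp_pr₁₃ :
    (kernelShearSchemeIso A hΘ).hom ≫ (pr₁₃ A A (A.dualOf Θ hΘ)).left = (kernelSpanMap A hΘ).left := rfl

/-- **The kernel leg `Ξ ≫ pr₂₃ : (A × A) × Â → A × Â`** (on `ℂ`-points `(a, b, β) ↦ (b, β · φ_Θ(ab))`) along which `𝒫^∨`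
is pulled back. [cite: Markman2025SecantWeil, §9.3 p. 71 L54–70] -/
def kernelSliceMap : (A.X ⊗ A.X) ⊗ (A.dualOf Θ hΘ).X ⟶ A.X ⊗ (A.dualOf Θ hΘ).X :=
  (kernelShearIso A hΘ).hom ≫ pr₂₃ A A (A.dualOf Θ hΘ)

end Shear

/-! ### §2 The span kernel `𝒩₁ = Ξ^*(pr₂₃^*𝒫^∨)` and the module-level re-parametrisation -/

section Kernel

variable (hK : A.KTheta Θ = ⊥)

/-- **The span kernel `𝒩₁ := Ξ^*(pr₂₃^*𝒫^∨)`** on `(A × A) × Â` — the pull-back of the dual Poincaré sheaf along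
`Ξ ≫ pr₂₃ = (b, β · φ_Θ(ab))`; a line bundle. [cite: Markman2025SecantWeil, §6 p. 26 L35–51] [cite: Mukai1981, §1 (1.1)] -/
def markmanSpanKernel : ((A.X ⊗ A.X) ⊗ (A.dualOf Θ hΘ).X).left.Modules :=
  (Scheme.Modules.pullback (kernelShearSchemeIso A hΘ).hom).obj
    ((Scheme.Modules.pullback (pr₂₃ A A (A.dualOf Θ hΘ)).left).obj (Modules.dual (poincareSheaf A hΘ hK)))

/-- `𝒩₁` is finite locally free. [cite: Mukai1981, §1 (1.1)] -/
theorem isFiniteLocallyFree_markmanSpanKernel : IsFiniteLocallyFree (markmanSpanKernel A hΘ hK) :=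
  ((isFiniteLocallyFree_dual (isFiniteLocallyFree_poincareSheaf A hΘ hK)).pullback _).pullback _

/-- `𝒩₁` has rank one. [cite: Mukai1981, §1 (1.1)] -/
theorem hasRank_markmanSpanKernel : HasRank (markmanSpanKernel A hΘ hK) 1 :=
  hasRank_pullback _ (hasRank_pullback _ (hasRank_dual (hasRank_poincareSheaf A hΘ hK)))

/-- `𝒩₁ ≅ (Ξ ≫ pr₂₃)^*𝒫^∨` (`pullbackComp`). [cite: Mukai1981, §1 (1.1)] -/
def markmanSpanKernelIsoPullbackSlice :
    markmanSpanKernel A hΘ hK ≅ (Scheme.Modules.pullback (kernelSliceMap A hΘ).left).obj (Modules.dual (poincareSheaf A hΘ hK)) :=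
  (pullbackComp (kernelShearSchemeIso A hΘ).hom (pr₂₃ A A (A.dualOf Θ hΘ)).left).app _

/-- `𝒩₁ ⊗ –` is left exact (a line bundle is invertible). [cite: StacksProject, Tag 0B8M] -/
theorem preservesFiniteLimits_tensor_markmanSpanKernel :
    PreservesFiniteLimits ((tensorBifunctor ((A.X ⊗ A.X) ⊗ (A.dualOf Θ hΘ).X).left).obj (markmanSpanKernel A hΘ hK)) :=
  (isInvertibleModule_of_hasRank_one (isFiniteLocallyFree_markmanSpanKernel A hΘ hK)
    (hasRank_markmanSpanKernel A hΘ hK)).preservesFiniteLimits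

/-- `𝒩₁ ⊗ –` is right exact. [cite: StacksProject, Tag 0B8M] -/
theorem preservesFiniteColimits_tensor_markmanSpanKernel :
    PreservesFiniteColimits ((tensorBifunctor ((A.X ⊗ A.X) ⊗ (A.dualOf Θ hΘ).X).left).obj (markmanSpanKernel A hΘ hK)) :=
  (isInvertibleModule_of_hasRank_one (isFiniteLocallyFree_markmanSpanKernel A hΘ hK)
    (hasRank_markmanSpanKernel A hΘ hK)).preservesFiniteColimits

/-- `μ^* ⋙ pr₁₂^* ⋙ Ξ^* ≅ pr₁₂^*` (from `Ξ ≫ pr₁₂ ≫ μ = pr₁₂`, `pullbackComp`). [cite: Markman2025SecantWeil, §6 p. 26 L34] -/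
def pullbackShearPr₁₂KernelShearIso :
    Scheme.Modules.pullback (shearSchemeIso A).hom ⋙ Scheme.Modules.pullback (pr₁₂ A A (A.dualOf Θ hΘ)).left ⋙
        Scheme.Modules.pullback (kernelShearSchemeIso A hΘ).hom ≅
      Scheme.Modules.pullback (pr₁₂ A A (A.dualOf Θ hΘ)).left :=
  Functor.isoWhiskerLeft _ (pullbackComp _ _) ≪≫ pullbackComp _ _ ≪≫
    pullbackCongr (by rw [Category.assoc, kernelShearSchemeIso_hom_comp])

/-- **Module-level re-parametrisation**: `Ξ^*(pr₂₃^*𝒫^∨ ⊗ pr₁₂^*μ^*M) ≅ 𝒩₁ ⊗ pr₁₂^*M` naturally in `M ∈ Mod(𝒪_{A×A})`,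
i.e. `μ^* ⋙ (pr₂₃^*𝒫^∨ ⊗ pr₁₂^*(–)) ⋙ Ξ^* ≅ (𝒩₁ ⊗ pr₁₂^*(–))` as functors (`pullbackTensorNatIsoOfLeft` for the flf factor
`pr₂₃^*𝒫^∨`, then `Ξ ≫ pr₁₂ ≫ μ = pr₁₂`). [cite: StacksProject, Tag 01CA] [cite: Markman2025SecantWeil, §6 p. 26 L34–51] -/
def markmanSpanKernelNatIso :
    Scheme.Modules.pullback (shearSchemeIso A).hom ⋙
        integralKernelFunctor (pr₁₂ A A (A.dualOf Θ hΘ)).left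
          ((Scheme.Modules.pullback (pr₂₃ A A (A.dualOf Θ hΘ)).left).obj (Modules.dual (poincareSheaf A hΘ hK))) ⋙
        Scheme.Modules.pullback (kernelShearSchemeIso A hΘ).hom ≅
      integralKernelFunctor (pr₁₂ A A (A.dualOf Θ hΘ)).left (markmanSpanKernel A hΘ hK) :=
  let K := (Scheme.Modules.pullback (pr₂₃ A A (A.dualOf Θ hΘ)).left).obj (Modules.dual (poincareSheaf A hΘ hK))
  have hKf : IsFiniteLocallyFree K := (isFiniteLocallyFree_dual (isFiniteLocallyFree_poincareSheaf A hΘ hK)).pullback _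
  -- `μ^* ⋙ (pr₁₂^* ⋙ (K ⊗ –)) ⋙ Ξ^* ≅ μ^* ⋙ pr₁₂^* ⋙ ((K ⊗ –) ⋙ Ξ^*) ≅ μ^* ⋙ pr₁₂^* ⋙ Ξ^* ⋙ (Ξ^*K ⊗ –) ≅ pr₁₂^* ⋙ (𝒩₁ ⊗ –)`
  Functor.isoWhiskerLeft (Scheme.Modules.pullback (shearSchemeIso A).hom) (Functor.associator _ _ _) ≪≫
    (Functor.associator _ _ _).symm ≪≫
    Functor.isoWhiskerLeft _ (pullbackTensorNatIsoOfLeft (kernelShearSchemeIso A hΘ).hom hKf) ≪≫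
    (Functor.associator _ _ _).symm ≪≫
    Functor.isoWhiskerRight ((Functor.associator _ _ _).symm ≪≫ pullbackShearPr₁₂KernelShearIso A hΘ) _

end Kernel

/-! ### §3 `Φ ≅ Φ^{pr₁₂, g′}_{𝒩₁}` on `D⁺` -/

section Span

variable (hK : A.KTheta Θ = ⊥) [HasDerivedCategory.{w₁} (A.X ⊗ A.X).left.Modules]
  [HasDerivedCategory.{w₂} ((A.X ⊗ A.X) ⊗ (A.dualOf Θ hΘ).X).left.Modules]
  [HasDerivedCategory.{w₃} (A.X ⊗ (A.dualOf Θ hΘ).X).left.Modules]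

/-- **MARKMAN'S `Φ` AS ONE SPAN TRANSFORM: `markmanPhiPlus A hΘ hK ≅ integralTransformPlus pr₁₂ g′ 𝒩₁`**, i.e.
`Φ(E•) ≅ Rg′_*(𝒩₁ ⊗ pr₁₂^*E•)` functorially on `D⁺(Mod 𝒪_{A×A})`, with `g′ = Ξ ≫ pr₁₃ = (a b⁻¹, β·φ_Θ(ab))` and the LINE
BUNDLE kernel `𝒩₁ = Ξ^*pr₂₃^*𝒫^∨` — `R pr₁₃_* ≅ D⁺(Ξ^*) ⋙ Rg′_*` (base change along the automorphism `Ξ`) and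
`Ξ^*(pr₂₃^*𝒫^∨ ⊗ pr₁₂^*μ^*M) ≅ 𝒩₁ ⊗ pr₁₂^*M`. Exactness instances of `pr₁₂^*` and `𝒩₁ ⊗ –` are binders (discharge with
`preservesFiniteLimits_pullback_pr₁₂`, `preservesFinite(Co)Limits_tensor_markmanSpanKernel`).
[cite: Markman2025SecantWeil, §6 p. 26 L34–51 and §9.3 p. 71 L44–70] [cite: Mukai1981, §1 (1.1), (1.4)] [cite: Hartshorne1977, III Prop. 9.3] -/
def markmanPhiPlusSpanIso [PreservesFiniteLimits (Scheme.Modules.pullback (pr₁₂ A A (A.dualOf Θ hΘ)).left)]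
    [PreservesFiniteLimits ((tensorBifunctor ((A.X ⊗ A.X) ⊗ (A.dualOf Θ hΘ).X).left).obj (markmanSpanKernel A hΘ hK))]
    [PreservesFiniteColimits ((tensorBifunctor ((A.X ⊗ A.X) ⊗ (A.dualOf Θ hΘ).X).left).obj (markmanSpanKernel A hΘ hK))] :
    markmanPhiPlus A hΘ hK ≅
      integralTransformPlus (pr₁₂ A A (A.dualOf Θ hΘ)).left (kernelSpanMap A hΘ).left (markmanSpanKernel A hΘ hK) := by
  haveI := preservesFiniteLimits_pullback_shear A
  haveI := preservesFiniteLimits_pullback_kernelShear A hΘ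
  let K := (Scheme.Modules.pullback (pr₂₃ A A (A.dualOf Θ hΘ)).left).obj (Modules.dual (poincareSheaf A hΘ hK))
  have hKf : IsFiniteLocallyFree K := (isFiniteLocallyFree_dual (isFiniteLocallyFree_poincareSheaf A hΘ hK)).pullback _
  have hK₁ : HasRank K 1 := hasRank_pullback _ (hasRank_dual (hasRank_poincareSheaf A hΘ hK))
  haveI := preservesFiniteLimits_tensor_pullback_pr₂₃ A A (A.dualOf Θ hΘ) (Modules.dual (poincareSheaf A hΘ hK))
    (isFiniteLocallyFree_dual (isFiniteLocallyFree_poincareSheaf A hΘ hK)) (hasRank_dual (hasRank_poincareSheaf A hΘ hK))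
  haveI := preservesFiniteColimits_tensor_pullback_pr₂₃ A A (A.dualOf Θ hΘ) (Modules.dual (poincareSheaf A hΘ hK))
    (isFiniteLocallyFree_dual (isFiniteLocallyFree_poincareSheaf A hΘ hK)) (hasRank_dual (hasRank_poincareSheaf A hΘ hK))
  let G := integralKernelFunctor (pr₁₂ A A (A.dualOf Θ hΘ)).left K
  haveI : G.Additive := additive_integralKernelFunctor _ _
  haveI : PreservesFiniteLimits G := preservesFiniteLimits_integralKernelFunctor _ _
  haveI : PreservesFiniteColimits G := preservesFiniteColimits_integralKernelFunctor _ _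
  let G' := integralKernelFunctor (pr₁₂ A A (A.dualOf Θ hΘ)).left (markmanSpanKernel A hΘ hK)
  haveI : G'.Additive := additive_integralKernelFunctor _ _
  haveI : PreservesFiniteLimits G' := preservesFiniteLimits_integralKernelFunctor _ _
  haveI : PreservesFiniteColimits G' := preservesFiniteColimits_integralKernelFunctor _ _
  let sh := Scheme.Modules.pullback (shearSchemeIso A).hom
  let ξ := Scheme.Modules.pullback (kernelShearSchemeIso A hΘ).hom
  let q := (pr₁₃ A A (A.dualOf Θ hΘ)).left
  -- `Φ = D⁺(μ^*) ⋙ D⁺(G) ⋙ R pr₁₃_*`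
  change sh.mapDerivedCategoryPlus ⋙ G.mapDerivedCategoryPlus ⋙ derivedPushforwardPlus q ≅
    G'.mapDerivedCategoryPlus ⋙ derivedPushforwardPlus ((kernelShearSchemeIso A hΘ).hom ≫ q)
  exact Functor.isoWhiskerLeft _ (Functor.isoWhiskerLeft _
      (derivedPushforwardPlusPullbackIsoCompIso (kernelShearSchemeIso A hΘ) q).symm) ≪≫
    -- `D⁺(μ^*) ⋙ D⁺(G) ⋙ D⁺(Ξ^*) ⋙ Rg′_*  ≅  D⁺(μ^* ⋙ G ⋙ Ξ^*) ⋙ Rg′_*  ≅  D⁺(G′) ⋙ Rg′_*`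
    Functor.isoWhiskerLeft _ (Functor.associator _ _ _).symm ≪≫
    (Functor.associator _ _ _).symm ≪≫
    Functor.isoWhiskerRight
      (Functor.isoWhiskerLeft _ (Functor.mapDerivedCategoryPlusCompIso G ξ).symm ≪≫
        (Functor.mapDerivedCategoryPlusCompIso sh (G ⋙ ξ)).symm ≪≫
        Functor.mapDerivedCategoryPlusIsoOfIso _ _ (markmanSpanKernelNatIso A hΘ hK)) _

/-- Objectwise form (instances discharged): `Φ(E) ≅ Φ^{pr₁₂, g′}_{𝒩₁}(E)` in `D⁺(Mod 𝒪_{A×Â})`. [cite: Markman2025SecantWeil, §6 p. 26 L34–51] -/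
theorem nonempty_markmanPhiPlus_obj_iso (E : DerivedCategory.Plus (A.X ⊗ A.X).left.Modules) :
    Nonempty ((markmanPhiPlus A hΘ hK).obj E ≅
      (haveI := preservesFiniteLimits_pullback_pr₁₂ A A (A.dualOf Θ hΘ)
       haveI := preservesFiniteLimits_tensor_markmanSpanKernel A hΘ hK
       haveI := preservesFiniteColimits_tensor_markmanSpanKernel A hΘ hK
       integralTransformPlus (pr₁₂ A A (A.dualOf Θ hΘ)).left (kernelSpanMap A hΘ).left (markmanSpanKernel A hΘ hK)).obj E) :=
  haveI := preservesFiniteLimits_pullback_pr₁₂ A A (A.dualOf Θ hΘ)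
  haveI := preservesFiniteLimits_tensor_markmanSpanKernel A hΘ hK
  haveI := preservesFiniteColimits_tensor_markmanSpanKernel A hΘ hK
  ⟨(markmanPhiPlusSpanIso A hΘ hK).app E⟩

end Span

end Literature.AlgebraicGeometry.AbelianVarieties

end
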